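import Summits.ResolutionOfSingularities.ResolutionOfSingularities.Theorems.PAlterationPialtStubNormalizeRR
import Literature.AlgebraicGeometry.Resolution.FiniteCoverCompactification
import HarnessLib

/-!
# `Pialt` (crux stmt-ResolutionOfSingularities-0555), line `SketchIdeator2` / Card A:
# merging finitely many local radicial covers — chart extension and domination

Helper file (`--supports stmt-ResolutionOfSingularities-0555`; STUB-PLAN
`Cruxes/Pialt/STUB-PLAN-stub_radicialPatching.md`, helpers H2 and H4). Together with
`exists_common_purelyInseparable_extension` (H3, `PAlterationPialtCommonPurelyInseparable.lean`)
this is the formal infrastructure of gap (a) of the crux notes ("ONE `L` for finitely many local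
purely inseparable fields"): local finite radicial NORMAL covers `Wᵢ → Uᵢ` of opens of a normal
variety `Z` extend to global ones `Z₁ᵢ → Z` (H2), their function fields embed into one finite
purely inseparable `L ⊇ K(Z)` (H3), and the normalisation `Z^L` dominates every `Z₁ᵢ` by a
finite, universally injective, surjective `Z`-morphism (H4).

* `exists_finite_radicial_cover_extending` (H2) — **field normal form of a chart**: for `Z`
  normal integral, locally of finite type over a field of characteristic `p`, `U ⊆ Z` open and
  `w : W → U` finite, universally injective, surjective with `W` integral NORMAL, the relative
  normalisation `Z₁ := (w ≫ U.ι).normalization` is integral and normal, `Z₁ → Z` is finite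
  (E. Noether, `isFinite_fromNormalization_comp_ι`), universally injective
  (`universallyInjective_fromNormalization`: `K(W)/K(Z)` is purely inseparable and `Z` is normal)
  and surjective, and `W = Z₁ ×_Z U` (`isPullback_toNormalization_fromNormalization`).
* `exists_hom_normalizationIn_of_algHom` (H4a) — **domination**: for `h : Z₁ → Z` integral
  dominant and a `K(Z)`-embedding `K(Z₁) → L`, the normalisation `Z^L` maps to `Z₁` over `Z` by
  an integral dominant morphism (universal property `Scheme.Hom.normalizationDesc` for
  `Spec L → Spec K(Z₁) → Z₁ → Z`).
* `exists_finite_universallyInjective_hom_normalizationIn` (H4b) — if moreover `Z` is normal of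
  finite type over a field of characteristic `p`, `h` is finite and `L/K(Z)` is finite purely
  inseparable, that morphism `Z^L → Z₁` is finite, universally injective and surjective
  (cancellation from `Z^L → Z`, which is so by `isFinite_normalizationInι` and
  `universallyInjective_normalizationInι_of_isPurelyInseparable`).

Sources: A. J. de Jong, Publ. Math. IHÉS 83 (1996), 4.16–4.17; Q. Liu, *Algebraic Geometry and
Arithmetic Curves* (2002), 4.1.24–4.1.27; Stacks Project, Tags 035H, 035I, 0BAK, 01S2–01S4.
-/

set_option linter.dupNamespace false -- mandated namespace of this single-conjunct summit

noncomputable section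

open CategoryTheory CategoryTheory.Limits AlgebraicGeometry TopologicalSpace
open Literature.AlgebraicGeometry.Resolution
open Literature.AlgebraicGeometry.Motives

namespace Summit.ResolutionOfSingularities.ResolutionOfSingularities.Theorems.Pialt.RadiciallyRegular

/-- The function field of a scheme locally of finite type over a field of characteristic `p` has
characteristic `p`. [folklore] -/
theorem charP_functionField_of_charP {p : ℕ} (k : Type) [Field k] [CharP k p] (Z : Scheme.{0})
    [IsIntegral Z] (f : Z ⟶ Spec (.of k)) : CharP Z.functionField p := by
  haveI : Nonempty (⊤ : Z.Opens) := ⟨⟨genericPoint Z, trivial⟩⟩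
  exact (((Z.germToFunctionField ⊤).hom.comp
    ((f.appTop).hom.comp (Scheme.ΓSpecIso (.of k)).inv.hom)).charP_iff_charP p).mp inferInstance

/-! ## H2 — field normal form of a chart -/

/-- **Extending a finite radicial normal cover of an open to the whole normal variety** (H2 of the
stub plan; de Jong 1996, 4.17: normalise `Z` in the cover). Let `k` be a field of characteristic
`p`, `Z` a NORMAL integral scheme locally of finite type over `k`, `U ⊆ Z` open and `w : W → U`
finite, universally injective and surjective with `W` integral and normal. Then there are an
integral normal `Z₁`, a finite, universally injective, surjective `h : Z₁ → Z` and an open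
immersion `i : W → Z₁` with `W = Z₁ ×_Z U` (`IsPullback i w h U.ι`): `Z₁` is the relative
normalisation of `Z` in `W → U ⊆ Z`. -/
theorem exists_finite_radicial_cover_extending (p : ℕ) [Fact p.Prime] (k : Type) [Field k]
    [CharP k p] (Z : Scheme.{0}) [IsIntegral Z] (f : Z ⟶ Spec (.of k)) [LocallyOfFiniteType f]
    (hN : ∀ z : Z, IsIntegrallyClosed (Z.presheaf.stalk z)) (U : Z.Opens) (W : Scheme.{0})
    [IsIntegral W] (w : W ⟶ (U : Scheme.{0})) [IsFinite w] [UniversallyInjective w]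
    (hw : Function.Surjective w.base) (hWn : ∀ x : W, IsIntegrallyClosed (W.presheaf.stalk x)) :
    ∃ (Z₁ : Scheme.{0}) (h : Z₁ ⟶ Z) (i : W ⟶ Z₁), IsIntegral Z₁ ∧
      (∀ z : Z₁, IsIntegrallyClosed (Z₁.presheaf.stalk z)) ∧ IsFinite h ∧
      UniversallyInjective h ∧ Function.Surjective h.base ∧ IsOpenImmersion i ∧
        IsPullback i w h U.ι := by
  haveI : IsLocallyNoetherian Z := LocallyOfFiniteType.isLocallyNoetherian f
  haveI : Surjective w := ⟨hw⟩
  haveI : IsDominant (w ≫ U.ι) := isDominant_comp_ι U w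
  haveI : CharP Z.functionField p := charP_functionField_of_charP k Z f
  -- `K(W)/K(Z)` is purely inseparable: `w ≫ U.ι` is universally injective and dominant
  haveI : UniversallyInjective (w ≫ U.ι) :=
    MorphismProperty.comp_mem _ _ _ (inferInstanceAs (UniversallyInjective w)) inferInstance
  haveI : IsPurelyInseparable Z.functionField (FunctionFieldOver (w ≫ U.ι)) :=
    Picover.FunctionFieldRadicial.stub_functionFieldRadicial W Z (w ≫ U.ι)
  -- the relative normalisation
  haveI hfin : IsFinite (w ≫ U.ι).fromNormalization := isFinite_fromNormalization_comp_ι U w f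
  haveI hui : UniversallyInjective (w ≫ U.ι).fromNormalization :=
    universallyInjective_fromNormalization (w ≫ U.ι) hN p
  haveI : IsDominant (w ≫ U.ι).fromNormalization := by
    have : IsDominant ((w ≫ U.ι).toNormalization ≫ (w ≫ U.ι).fromNormalization) := by
      rw [(w ≫ U.ι).toNormalization_fromNormalization]; infer_instance
    exact IsDominant.of_comp (w ≫ U.ι).toNormalization (w ≫ U.ι).fromNormalization
  have hs : Surjective (w ≫ U.ι).fromNormalization :=
    surjective_of_isDominant_of_isClosed_range _
      (w ≫ U.ι).fromNormalization.isClosedMap.isClosed_range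
  exact ⟨(w ≫ U.ι).normalization, (w ≫ U.ι).fromNormalization, (w ≫ U.ι).toNormalization,
    inferInstance, isIntegrallyClosed_stalk_normalization_of_normal (w ≫ U.ι) hWn, hfin, hui, hs.1,
    isOpenImmersion_toNormalization w U.ι, isPullback_toNormalization_fromNormalization w U.ι⟩

/-! ## H4 — `Z^L` dominates every intermediate finite radicial cover -/

/-- **The normalisation of `Z` in `L` maps to every integral `Z`-scheme whose function field
embeds into `L`** (H4a of the stub plan; Stacks 035I, universal property of the relative
normalisation): for `h : Z₁ → Z` integral and dominant between integral schemes and a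
`K(Z)`-algebra homomorphism `e : K(Z₁) → L`, there is an integral dominant `δ : Z^L → Z₁` with
`δ ≫ h = (Z^L → Z)` — `Scheme.Hom.normalizationDesc` for the factorisation
`Spec L → Spec K(Z₁) → Z₁ → Z` of `Spec L → Z`. -/
theorem exists_hom_normalizationIn_of_algHom (Z : Scheme.{0}) [IsIntegral Z] (L : Type)
    [Field L] [Algebra Z.functionField L] {Z₁ : Scheme.{0}} [IsIntegral Z₁] (h : Z₁ ⟶ Z)
    [IsIntegralHom h] [IsDominant h] (e : FunctionFieldOver h →ₐ[Z.functionField] L) :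
    ∃ δ : normalizationIn Z L ⟶ Z₁,
      δ ≫ h = normalizationInι Z L ∧ IsIntegralHom δ ∧ IsDominant δ := by
  -- `Spec L → Spec K(Z₁) → Z₁` (the codomain of `ι` is ascribed as `Spec K(Z₁)` so that the
  -- instances carried by `fromSpecFunctionField Z₁` are found syntactically)
  let ι : Spec (.of L) ⟶ Spec Z₁.functionField := Spec.map (CommRingCat.ofHom e.toRingHom)
  let f₁ : Spec (.of L) ⟶ Z₁ := ι ≫ fromSpecFunctionField Z₁
  have H : fromSpecExtension Z L = f₁ ≫ h := by
    have h1 : f₁ ≫ h = ι ≫ fromSpecExtension Z (FunctionFieldOver h) := by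
      rw [Picover.OfNormalizationIn.fromSpecExtension_functionFieldOver h]
      rfl
    rw [h1]
    change Spec.map (CommRingCat.ofHom (algebraMap Z.functionField L)) ≫ fromSpecFunctionField Z =
      Spec.map (CommRingCat.ofHom e.toRingHom) ≫ Spec.map (CommRingCat.ofHom
        (algebraMap Z.functionField (FunctionFieldOver h))) ≫ fromSpecFunctionField Z
    rw [← Category.assoc, ← Spec.map_comp]
    congr 2
    ext x
    change algebraMap Z.functionField L x = e (algebraMap Z.functionField (FunctionFieldOver h) x)
    rw [AlgHom.commutes]
  -- the universal property of `Z^L = (Spec L → Z).normalization`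
  let δ : normalizationIn Z L ⟶ Z₁ := (fromSpecExtension Z L).normalizationDesc f₁ h H
  have hδ : δ ≫ h = normalizationInι Z L := (fromSpecExtension Z L).normalizationDesc_comp f₁ h H
  have hδ' : (fromSpecExtension Z L).toNormalization ≫ δ = f₁ :=
    (fromSpecExtension Z L).toNormalization_normalizationDesc f₁ h H
  have hint : IsIntegralHom δ :=
    inferInstanceAs (IsIntegralHom ((fromSpecExtension Z L).normalizationDesc f₁ h H))
  -- dominance: `Spec L → Spec K(Z₁)` is onto (one point) and `Spec K(Z₁) → Z₁` is dominant
  haveI : Surjective ι := ⟨fun _ => ⟨IsLocalRing.closedPoint L,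
    Subsingleton.elim (α := PrimeSpectrum Z₁.functionField) _ _⟩⟩
  haveI : IsDominant f₁ := by
    change IsDominant (ι ≫ fromSpecFunctionField Z₁)
    infer_instance
  have hdomc : IsDominant ((fromSpecExtension Z L).toNormalization ≫ δ) := by
    rw [hδ']
    infer_instance
  exact ⟨δ, hδ, hint, IsDominant.of_comp (fromSpecExtension Z L).toNormalization δ (H := hdomc)⟩

/-- **`Z^L → Z₁` is finite, universally injective and surjective** (H4b of the stub plan): for
`Z` NORMAL integral, locally of finite type over a field of characteristic `p`, `L/K(Z)` finite
purely inseparable, `h : Z₁ → Z` finite dominant from an integral `Z₁` and a `K(Z)`-embedding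
`K(Z₁) → L`, the `Z`-morphism `δ : Z^L → Z₁` of `exists_hom_normalizationIn_of_algHom` is finite
and universally injective (left cancellation in `δ ≫ h = (Z^L → Z)`, which is finite by
E. Noether and universally injective as `Z` is normal) and surjective (dominant, closed image). -/
theorem exists_finite_universallyInjective_hom_normalizationIn (p : ℕ) [Fact p.Prime] (k : Type)
    [Field k] [CharP k p] (Z : Scheme.{0}) [IsIntegral Z] (f : Z ⟶ Spec (.of k))
    [LocallyOfFiniteType f] (hN : ∀ z : Z, IsIntegrallyClosed (Z.presheaf.stalk z)) (L : Type)
    [Field L] [Algebra Z.functionField L] [FiniteDimensional Z.functionField L]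
    [IsPurelyInseparable Z.functionField L] {Z₁ : Scheme.{0}} [IsIntegral Z₁] (h : Z₁ ⟶ Z)
    [IsFinite h] [IsDominant h] (e : FunctionFieldOver h →ₐ[Z.functionField] L) :
    ∃ δ : normalizationIn Z L ⟶ Z₁, δ ≫ h = normalizationInι Z L ∧ IsFinite δ ∧
      UniversallyInjective δ ∧ Function.Surjective δ.base := by
  obtain ⟨δ, hδ, hint, hdom⟩ := exists_hom_normalizationIn_of_algHom Z L h e
  haveI := hint
  haveI := hdom
  haveI : CharP Z.functionField p := charP_functionField_of_charP k Z f
  haveI : IsFinite (normalizationInι Z L) := isFinite_normalizationInι Z L f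
  haveI : UniversallyInjective (normalizationInι Z L) :=
    universallyInjective_normalizationInι_of_isPurelyInseparable Z L p hN
  haveI : IsFinite (δ ≫ h) := by
    rw [hδ]
    infer_instance
  haveI : IsFinite δ := IsFinite.of_comp δ h
  haveI : UniversallyInjective (δ ≫ h) := by
    rw [hδ]
    infer_instance
  haveI : UniversallyInjective δ := universallyInjective_of_comp δ h
  have hs : Surjective δ := surjective_of_isDominant_of_isClosed_range δ δ.isClosedMap.isClosed_range
  exact ⟨δ, hδ, inferInstance, inferInstance, hs.1⟩

end Summit.ResolutionOfSingularities.ResolutionOfSingularities.Theorems.Pialt.RadiciallyRegular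

end
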